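import Summits.BirchSwinnertonDyer.BirchSwinnertonDyer.Theorems.UniversalToricDescentProPrimeToPVanishing
import Literature.NumberTheory.GaloisRepresentations.TameInertiaCoinvariantsEvaluationProofs
import Literature.NumberTheory.GaloisRepresentations.EulerSystem
import Literature.NumberTheory.GaloisRepresentations.ConjugationDescent
import Literature.NumberTheory.GaloisRepresentations.ProfiniteIntersectionCocycleExtension
import Literature.NumberTheory.EllipticCurves.GaloisAction
import HarnessLib

/-!
# Route UniversalToricDescent — local lemmas for the coinvariant evaluation `H¹(I_F, A) ≃ A ⧸ (ρ τ − 1)A`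
# (Greenberg–Vatsal Prop. (2.4) at a place with unipotent inertia, part 1)

Lead prover bsd-wall-utd-p1 g9 (`--supports stmt-BirchSwinnertonDyer-20399`). For a non-archimedean local
field `F` of residue characteristic `≠ p`, a continuous `ℤ_p`-linear representation `ρ` of `Γ_F` on a
discrete `p`-primary `A`, `I = I_F`, and the Literature evaluation bijection
`e : H¹(I_F, A) ≃ A ⧸ (ρ τ − 1)A` at a tame `p`-generator `τ` with its Frobenius rule
(`TameInertiaCoinvariantsEvaluationProofs`):

* §1 `natCard_invariants_pTorsion_eq_of_rep` — bookkeeping between the two currencies of `H¹(I, A)` for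
  a subgroup `Hi ⊇ I`: the `ℤ`-linear `H¹(I ∩ Hi, A)` of the discrete `Hi`-module (`discreteTopRep`,
  conjugation by `Hi`) and the `ℤ_p`-linear `H¹(I, A)` of `ρ.toTopRep` (conjugation by `Γ_F`): the
  `Hi`-invariant classes killed by `p` correspond (same cocycles, same coboundaries, same conjugation).
* §2 `exists_subgroup_mem_iff_conjMap_eq` (stabilisers are subgroups containing `I`),
  `exists_openNormalSubgroup_forall_conjMap_eq` (finitely many classes have a common open normal
  stabiliser), `pow_residueFieldCard_nsmul_equiv_conjMap_pow` (**`q^n • e(φ^n·c) = ρ̄(φ^n) e(c)`**, the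
  Frobenius rule iterated), `eq_of_pow_nsmul_eq_of_coprime` (`q^n` is injective on a `p`-primary group).

The sequel `UniversalToricDescentCoinvariantLocalCount` performs the Frobenius reduction over a
`ℤ_p`-extension. THEOREMS ONLY; no definition, no named fact, no `sorry`. BSD is not advanced by this file.
References: [GreenbergVatsal2000] §2 Prop. (2.4) and proof (arXiv p. 22); [SerreInventiones1972] §1.8 Prop. 6;
[SerreLocalFields1979] VII §5 Prop. 3, XIII §1 Prop. 1; [SerreGaloisCohomology1997] I §2.2, §5.8.
-/

set_option autoImplicit false
-- `…BirchSwinnertonDyer.BirchSwinnertonDyer.Theorems…` is the problem's mandated namespace (D-0017).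
set_option linter.dupNamespace false

noncomputable section

open scoped Classical

namespace Summit.BirchSwinnertonDyer.BirchSwinnertonDyer.Theorems.UniversalToricDescentCoinvariantLocalLemmas

open NumberField IsDedekindDomain Field ValuativeRel
open Literature.NumberTheory.EllipticCurves Literature.NumberTheory.GaloisRepresentations
  Literature.NumberTheory.GaloisRepresentations.IsNonarchimedeanLocalField
  IsDedekindDomain.HeightOneSpectrum ContinuousCohomology CategoryTheory Topology
  Summit.BirchSwinnertonDyer.BirchSwinnertonDyer.Theorems.UniversalToricDescentProPrimeToP


/-! ### §1 The two currencies of `H¹(I, A)` -/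

section Currency

variable {G : Type} [Group G] [TopologicalSpace G] [IsTopologicalGroup G]
  (I Hi : Subgroup G) [hIn : I.Normal] {p : ℕ} [Fact p.Prime]
  {A : Type} [AddCommGroup A] [Module ℤ_[p] A] [DistribMulAction G A] [TopologicalSpace A]
  [DiscreteTopology A] [ContinuousSMul ℤ_[p] A]

/-- **`H¹(I ∩ Hi, A)^{Hi}[p]` in the `ℤ`-currency and in the `ℤ_p`-currency have the same cardinality.**
For a topological group `G`, a normal subgroup `I ≤ Hi ≤ G`, a discrete `G`-module `A` which is also a
`ℤ_p`-module, and a continuous `ℤ_p`-linear representation `ρ` of `G` on `A` with `ρ g a = g • a`: the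
classes of `H¹(I.subgroupOf Hi, A)` (cohomology of the `ℤ`-linear `discreteTopRep Hi A`) fixed by every
`h ∈ Hi` and killed by `p` are in bijection with the classes of `H¹(I, A)` (cohomology of `ρ.toTopRep`)
fixed by every `h ∈ Hi` and killed by `p` — cocycles are the same functions `I → A`, coboundaries and the
conjugation action `(h·z)(x) = h • z(h⁻¹ x h)` correspond. [cite: SerreGaloisCohomology1997, I §2.3, §5.8]
[cite: GreenbergVatsal2000, §2 Prop. (2.4) (proof)] -/
theorem natCard_invariants_pTorsion_eq_of_rep (hle : I ≤ Hi) (ρ : ContinuousRep G ℤ_[p] A)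
    (hρ : ∀ (g : G) (a : A), ρ g a = g • a) :
    Nat.card {y : continuousCohomology 1 (subgroupRep (discreteTopRep Hi A) (I.subgroupOf Hi)) //
        (∀ h : Hi, conjMap (discreteTopRep Hi A) (I.subgroupOf Hi) h 1 y = y) ∧ p • y = 0} =
      Nat.card {c : continuousCohomology 1 (subgroupRep ρ.toTopRep I) //
        (∀ h : G, h ∈ Hi → conjMap ρ.toTopRep I h 1 c = c) ∧ p • c = 0} := by
  -- notation
  let N : Subgroup Hi := I.subgroupOf Hi
  let X : TopRep ℤ Hi := discreteTopRep Hi A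
  let XN : TopRep ℤ N := subgroupRep X N
  let Y : TopRep ℤ_[p] G := ρ.toTopRep
  let YI : TopRep ℤ_[p] I := subgroupRep Y I
  have hXN : ∀ (n : N) (a : A), XN.ρ n a = ((n : Hi) : G) • a := fun _ _ ↦ rfl
  have hYI : ∀ (y : I) (a : A), YI.ρ y a = (y : G) • a := fun y a ↦ hρ y a
  -- `I ≃ N` on elements
  let eN : I → N := fun x ↦ ⟨⟨x.1, hle x.2⟩, Subgroup.mem_subgroupOf.mpr x.2⟩
  have heN : Continuous eN := (continuous_subtype_val.subtype_mk _).subtype_mk _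
  let eI : N → I := fun x ↦ ⟨x.1.1, Subgroup.mem_subgroupOf.mp x.2⟩
  have heI : Continuous eI := (continuous_subtype_val.comp continuous_subtype_val).subtype_mk _
  have heNI : ∀ n, eN (eI n) = n := fun _ ↦ rfl
  have heIN : ∀ x, eI (eN x) = x := fun _ ↦ rfl
  -- cocycle transport
  let Φ : contOneCocycles XN → contOneCocycles YI := fun φ ↦
    ⟨⟨fun y ↦ φ.1 (eN y), φ.1.continuous.comp heN⟩, fun y y' ↦ by
      show φ.1 (eN (y * y')) = φ.1 (eN y) + YI.ρ y (φ.1 (eN y'))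
      rw [hYI, show eN (y * y') = eN y * eN y' from rfl, φ.2, hXN]⟩
  have hΦ : ∀ φ y, (Φ φ).1 y = φ.1 (eN y) := fun _ _ ↦ rfl
  let Ψ : contOneCocycles YI → contOneCocycles XN := fun ψ ↦
    ⟨⟨fun n ↦ ψ.1 (eI n), ψ.1.continuous.comp heI⟩, fun n n' ↦ by
      show ψ.1 (eI (n * n')) = ψ.1 (eI n) + XN.ρ n (ψ.1 (eI n'))
      rw [hXN, show eI (n * n') = eI n * eI n' from rfl, ψ.2, hYI]⟩
  have hΦΨ : ∀ ψ, Φ (Ψ ψ) = ψ := fun ψ ↦ Subtype.ext (ContinuousMap.ext fun _ ↦ rfl)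
  have hΦadd : ∀ φ φ', Φ (φ + φ') = Φ φ + Φ φ' := fun _ _ ↦ Subtype.ext (ContinuousMap.ext fun _ ↦ rfl)
  -- the class-level map
  let ev : contOneCocycles XN →ₗ[ℤ] continuousCohomology 1 YI :=
    (AddMonoidHom.mk' (fun φ ↦ oneCocycleClass YI (Φ φ)) fun φ φ' ↦ by
      show oneCocycleClass YI (Φ (φ + φ')) = _
      rw [hΦadd, oneCocycleClass_add]).toIntLinearMap
  have hev_apply : ∀ φ, ev φ = oneCocycleClass YI (Φ φ) := fun _ ↦ rfl
  have hev : ∀ φ, oneCocycleClass XN φ = 0 → ev φ = 0 := fun φ hφ ↦ by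
    obtain ⟨v, hv⟩ := (oneCocycleClass_eq_zero_iff XN φ).1 hφ
    rw [hev_apply, oneCocycleClass_eq_zero_iff]
    exact ⟨v, fun y ↦ by rw [hΦ, hv, hXN, hYI]⟩
  let T := liftH1ₗ XN ev hev
  have hT : ∀ φ, T (oneCocycleClass XN φ) = oneCocycleClass YI (Φ φ) := fun φ ↦
    liftH1ₗ_oneCocycleClass XN ev hev φ
  -- `T` is a bijection
  have hTinj : Function.Injective T := by
    rw [injective_iff_map_eq_zero]
    intro c hc
    obtain ⟨φ, rfl⟩ := oneCocycleClass_surjective XN c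
    rw [hT, oneCocycleClass_eq_zero_iff] at hc
    obtain ⟨v, hv⟩ := hc
    rw [oneCocycleClass_eq_zero_iff]
    exact ⟨v, fun n ↦ by rw [← heNI n, ← hΦ, hv, hYI, hXN]⟩
  have hTsurj : Function.Surjective T := fun c ↦ by
    obtain ⟨ψ, rfl⟩ := oneCocycleClass_surjective YI c
    exact ⟨oneCocycleClass XN (Ψ ψ), by rw [hT, hΦΨ]⟩
  -- `T` intertwines the conjugation actions of `h ∈ Hi`
  have hTconj : ∀ (h : Hi) (c : continuousCohomology 1 XN),
      T (conjMap X N h 1 c) = conjMap Y I (h : G) 1 (T c) := by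
    intro h c
    obtain ⟨φ, rfl⟩ := oneCocycleClass_surjective XN c
    rw [conjMap_oneCocycleClass, hT, hT, conjMap_oneCocycleClass]
    congr 1
    refine Subtype.ext (ContinuousMap.ext fun y ↦ ?_)
    rw [hΦ, conj_pullback_apply, conj_pullback_apply, hΦ]
    show (h : G) • φ.1 (subgroupConj N h (eN y)) = ρ (h : G) (φ.1 (eN (subgroupConj I (h : G) y)))
    rw [hρ]
    rfl
  -- count
  refine Nat.card_congr (Equiv.ofBijective
    (fun y ↦ (⟨T y.1, fun h hh ↦ by rw [← hTconj ⟨h, hh⟩, y.2.1 ⟨h, hh⟩],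
      by rw [← map_nsmul, y.2.2, map_zero]⟩ :
      {c : continuousCohomology 1 YI // (∀ h : G, h ∈ Hi → conjMap Y I h 1 c = c) ∧ p • c = 0}))
    ⟨?_, ?_⟩)
  · rintro ⟨y, hy⟩ ⟨y', hy'⟩ h
    exact Subtype.ext (hTinj (congrArg Subtype.val h))
  · rintro ⟨c, hc, hpc⟩
    obtain ⟨y, rfl⟩ := hTsurj c
    refine ⟨⟨y, fun h ↦ hTinj (by rw [hTconj, hc h h.2]), hTinj (by rw [map_nsmul, hpc, map_zero])⟩,
      rfl⟩

end Currency

/-! ### §2 Local lemmas: stabilisers, open stabilisers, the iterated Frobenius rule -/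

section LocalLemmas

variable {F : Type} [Field F] [ValuativeRel F] [TopologicalSpace F] [IsNonarchimedeanLocalField F]
  {p : ℕ} [Fact p.Prime]
variable {A : Type} [AddCommGroup A] [Module ℤ_[p] A] [TopologicalSpace A] [DiscreteTopology A]
  [ContinuousSMul ℤ_[p] A]

/-- The stabiliser of a class `c ∈ H¹(I_F, A)` under the conjugation action of `Γ_F` is a subgroup
containing `I_F` (inner automorphisms act trivially on cohomology). [cite: SerreLocalFields1979, VII §5 Prop. 3] -/
theorem exists_subgroup_mem_iff_conjMap_eq (ρ : ContinuousRep (absoluteGaloisGroup F) ℤ_[p] A)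
    (c : continuousCohomology 1 (subgroupRep ρ.toTopRep (absInertia F))) :
    ∃ S : Subgroup (absoluteGaloisGroup F), absInertia F ≤ S ∧
      ∀ g, g ∈ S ↔ conjMap ρ.toTopRep (absInertia F) g 1 c = c := by
  let Y : TopRep ℤ_[p] (absoluteGaloisGroup F) := ρ.toTopRep
  let I : Subgroup (absoluteGaloisGroup F) := absInertia F
  refine ⟨{ carrier := {g | conjMap Y I g 1 c = c}
            one_mem' := conjMap_one_one Y I c
            mul_mem' := fun {a b} ha hb ↦ by
              show conjMap Y I (a * b) 1 c = c
              rw [conjMap_mul_apply_one, hb, ha]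
            inv_mem' := fun {a} ha ↦ by
              show conjMap Y I a⁻¹ 1 c = c
              conv_lhs => rw [← ha]
              rw [← conjMap_mul_apply_one, inv_mul_cancel, conjMap_one_one] },
    fun i hi ↦ conjMap_eq_self_of_mem_one Y I hi c, fun _ ↦ Iff.rfl⟩

/-- **A common open normal stabiliser.** If the classes of `H¹(I_F, A)` killed by `p` form a finite set,
there is an open normal subgroup `N₀ ≤ Γ_F` fixing all of them under conjugation: a class is
represented by a continuous cocycle `z` on the compact `I_F` with finitely many values, `z(g⁻¹xg) = z(x)`
for `g` near `1` uniformly in `x`, and `ρ(g)` fixes the values of `z` for `g` near `1`.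
[cite: SerreGaloisCohomology1997, I §2.2 (discrete modules: every class is fixed by an open subgroup)] -/
theorem exists_openNormalSubgroup_forall_conjMap_eq (ρ : ContinuousRep (absoluteGaloisGroup F) ℤ_[p] A)
    (hT : Finite {c : continuousCohomology 1 (subgroupRep ρ.toTopRep (absInertia F)) // p • c = 0}) :
    letI : CompactSpace (absoluteGaloisGroup F) := absoluteGaloisGroup_compactSpace F
    ∃ N₀ : OpenNormalSubgroup (absoluteGaloisGroup F),
      ∀ c : continuousCohomology 1 (subgroupRep ρ.toTopRep (absInertia F)), p • c = 0 →
        ∀ g ∈ N₀.toSubgroup, conjMap ρ.toTopRep (absInertia F) g 1 c = c := by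
  -- notation
  let G : Type := absoluteGaloisGroup F
  let I : Subgroup G := absInertia F
  let Y : TopRep ℤ_[p] G := ρ.toTopRep
  let YI : TopRep ℤ_[p] I := subgroupRep Y I
  let T : Type := {c : continuousCohomology 1 YI // p • c = 0}
  haveI : CompactSpace G := absoluteGaloisGroup_compactSpace F
  haveI : CompactSpace I := isCompact_iff_compactSpace.mp (isClosed_absInertia_holds F).isCompact
  haveI : Finite T := hT
  have hrep : ∀ c : T, ∃ z : contOneCocycles YI, oneCocycleClass YI z = c.1 := fun c ↦
    oneCocycleClass_surjective YI c.1
  choose z hz using hrep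
  let cj : G → I → I := fun g x ↦ ⟨g⁻¹ * x * g, (absInertia.normal (F := F)).conj_mem' x x.2 g⟩
  -- uniform local constancy in the conjugating variable
  have hV : ∀ c : T, ∃ V ∈ 𝓝 (1 : G), ∀ g ∈ V, ∀ x : I, (z c).1 (cj g x) = (z c).1 x := fun c ↦ by
    obtain ⟨V, hV, hVf⟩ := exists_nhds_one_forall_eq' (X := I) (P := G)
      (fun x g ↦ (z c).1 (cj g x))
      ((z c).1.continuous.comp (Continuous.subtype_mk
        (((continuous_snd.inv).mul (continuous_subtype_val.comp continuous_fst)).mul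
          continuous_snd) _))
    refine ⟨V, hV, fun g hg x ↦ ?_⟩
    rw [hVf x g hg]
    exact congrArg _ (Subtype.ext (by simp [cj]))
  choose V hV hVf using hV
  -- the stabilisers of the finitely many values of the representatives
  have hW : ∀ c : T, {g : G | ∀ x : I, ρ g ((z c).1 x) = (z c).1 x} ∈ 𝓝 (1 : G) := fun c ↦ by
    have hfr : (Set.range fun x : I ↦ ((z c).1 x : A)).Finite :=
      (isCompact_range (z c).1.continuous).finite_of_discrete
    have hset : {g : G | ∀ x : I, ρ g ((z c).1 x) = (z c).1 x} =
        ⋂ a ∈ Set.range (fun x : I ↦ ((z c).1 x : A)), {g : G | ρ g a = a} := by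
      ext g
      simp only [Set.mem_setOf_eq, Set.mem_iInter, Set.mem_range, forall_exists_index,
        forall_apply_eq_imp_iff]
    rw [hset]
    refine (Filter.biInter_mem hfr).2 fun a _ ↦ ?_
    have hc : Continuous fun g : G ↦ ρ g a :=
      ρ.continuous_smul.comp (continuous_id.prodMk continuous_const)
    exact ((isOpen_discrete ({a} : Set A)).preimage hc).mem_nhds (by
      show ρ 1 a ∈ ({a} : Set A)
      rw [map_one]; rfl)
  have hWV : ((⋂ c, V c) ∩ ⋂ c : T, {g : G | ∀ x : I, ρ g ((z c).1 x) = (z c).1 x}) ∈ 𝓝 (1 : G) :=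
    Filter.inter_mem (Filter.iInter_mem.2 hV) (Filter.iInter_mem.2 hW)
  obtain ⟨N₀, hN₀⟩ := ProfiniteGrp.exist_openNormalSubgroup_sub_open_nhds_of_one isOpen_interior
    (mem_interior_iff_mem_nhds.2 hWV)
  have hN₀' : (N₀ : Set G) ⊆ (⋂ c, V c) ∩ ⋂ c : T, {g : G | ∀ x : I, ρ g ((z c).1 x) = (z c).1 x} :=
    hN₀.trans interior_subset
  refine ⟨N₀, fun c hpc g hg ↦ ?_⟩
  have hg' := hN₀' hg
  have hzc : oneCocycleClass YI (z ⟨c, hpc⟩) = c := hz ⟨c, hpc⟩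
  rw [← hzc, conjMap_oneCocycleClass]
  congr 1
  refine Subtype.ext (ContinuousMap.ext fun x ↦ ?_)
  rw [conj_pullback_apply]
  show ρ g ((z ⟨c, hpc⟩).1 (subgroupConj I g x)) = (z ⟨c, hpc⟩).1 x
  have h1 : (z ⟨c, hpc⟩).1 (subgroupConj I g x) = (z ⟨c, hpc⟩).1 (cj g x) :=
    congrArg _ (Subtype.ext (subgroupConj_apply_coe I g x))
  rw [h1, hVf ⟨c, hpc⟩ g (Set.mem_iInter.mp hg'.1 ⟨c, hpc⟩) x]
  exact (Set.mem_iInter.mp hg'.2 ⟨c, hpc⟩) x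

/-- **The Frobenius rule, iterated: `q^n • e(φ^n·c) = ρ̄(φ^n) (e c)`** for the coinvariant evaluation
bijection `e : H¹(I_F, A) ≃ A ⧸ (ρ τ − 1)A` and an arithmetic Frobenius `φ` (induction on `n` from the
Literature rule `q • e(φ·c) = ρ̄(φ) e(c)`, `residueFieldCard_nsmul_equiv_conjMap_coinvariants`).
[cite: GreenbergVatsal2000, §2, proof of Prop. (2.4) (arXiv p. 22)] [cite: SerreInventiones1972, §1.8 Prop. 6] -/
theorem pow_residueFieldCard_nsmul_equiv_conjMap_pow
    (ρ : ContinuousRep (absoluteGaloisGroup F) ℤ_[p] A) (hℓ : ringChar 𝓀[F] ≠ p)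
    (hA : ∀ a : A, ∃ k : ℕ, p ^ k • a = 0) (hfin : ∀ k : ℕ, Set.Finite {a : A | p ^ k • a = 0})
    (hP : ∀ σ ∈ absInertia F, ∀ a : A, ∃ k : ℕ, ((ρ σ) ^ p ^ k) a = a)
    {τ : ↥(absInertia F)}
    (hτ : ∀ (B : Type) [Group B] [TopologicalSpace B] [DiscreteTopology B], IsPGroup p B →
        ∀ f : ↥(absInertia F) →* B, Continuous f → f.range = Subgroup.zpowers (f τ))
    {φ : absoluteGaloisGroup F} (hφ : IsFrobPow φ 1)
    (e : continuousCohomology 1 (subgroupRep ρ.toTopRep (absInertia F)) ≃ₗ[ℤ_[p]]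
        (A ⧸ LinearMap.range (ρ (τ : absoluteGaloisGroup F) - 1)))
    (he : ∀ z, e (oneCocycleClass _ z) = Submodule.Quotient.mk (z.1 τ)) (n : ℕ)
    (c : continuousCohomology 1 (subgroupRep ρ.toTopRep (absInertia F))) :
    (residueFieldCard F ^ n) • e (conjMap ρ.toTopRep (absInertia F) (φ ^ n) 1 c) =
      Submodule.mapQ _ _ (ρ (φ ^ n)) (range_sub_one_le_comap F ρ hA hfin hP hτ (φ ^ n)) (e c) := by
  let Φq := Submodule.mapQ _ _ (ρ φ) (range_sub_one_le_comap F ρ hA hfin hP hτ φ)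
  -- `q^n • e(φ^n·c) = Φq^n (e c)`
  have hiter : ∀ (n : ℕ) (c : continuousCohomology 1 (subgroupRep ρ.toTopRep (absInertia F))),
      (residueFieldCard F ^ n) • e (conjMap ρ.toTopRep (absInertia F) (φ ^ n) 1 c) = (Φq ^ n) (e c) := by
    intro n
    induction n with
    | zero =>
      intro c
      rw [pow_zero, one_smul, pow_zero, conjMap_one_one, pow_zero, Module.End.one_apply]
    | succ n ih =>
      intro c
      rw [pow_succ' φ, conjMap_mul_apply_one, pow_succ, mul_smul,
        residueFieldCard_nsmul_equiv_conjMap_coinvariants F ρ hℓ hA hfin hP hτ hφ e he,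
        ← map_nsmul, ih, pow_succ', Module.End.mul_apply]
  -- `Φq^n = ρ̄(φ^n)` on the quotient
  rw [hiter]
  obtain ⟨a, ha⟩ := Submodule.Quotient.mk_surjective _ (e c)
  rw [← ha, Submodule.mapQ_apply, map_pow]
  clear ha
  induction n with
  | zero => rw [pow_zero, Module.End.one_apply, pow_zero, Module.End.one_apply]
  | succ n ih =>
    rw [pow_succ', Module.End.mul_apply, ih, pow_succ', Module.End.mul_apply]
    rfl

omit [TopologicalSpace F] [IsNonarchimedeanLocalField F] [TopologicalSpace A] [DiscreteTopology A]
  [ContinuousSMul ℤ_[p] A] [Module ℤ_[p] A] [Fact p.Prime] in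
/-- Multiplication by a power of an integer prime to `p` is injective on an abelian group in which every
element has `p`-power order (Bézout). [folklore] -/
theorem eq_of_pow_nsmul_eq_of_coprime {q : ℕ} (hq : q.Coprime p) {M : Type} [AddCommGroup M]
    (hM : ∀ x : M, ∃ k : ℕ, p ^ k • x = 0) (n : ℕ) (x y : M) (h : (q ^ n) • x = (q ^ n) • y) :
    x = y := by
  obtain ⟨k, hk⟩ := hM (x - y)
  obtain ⟨a, ha⟩ := exists_int_forall_eq_smul_nsmul (M := M) (hq.pow_left n) k
  have h0 : ((q ^ n : ℕ) : ℤ) • (x - y) = 0 := by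
    rw [natCast_zsmul, nsmul_sub, h, sub_self]
  have := ha (x - y) hk
  rw [h0, zsmul_zero] at this
  exact sub_eq_zero.mp this

end LocalLemmas

end Summit.BirchSwinnertonDyer.BirchSwinnertonDyer.Theorems.UniversalToricDescentCoinvariantLocalLemmas

end
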